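import Literature.MathematicalPhysics.QuantumFieldTheory.Balaban1983to89.Beta.KernelWard
import Summits.QuantumFields.BalabanUV.Beta.D1BFx.ContactCount

/-!
# `BalabanUV.Beta.FP.KernelWardBoundedBricks` — road «FP» for binder row D1, sub-row **H2-ASM-5a** (symmetry letters of `PiBF`), module W1 part 1∕2: the
# RIGHT-LOCALISED FUBINI BRICKS for a **BOUNDED** leg and the linearity of tadpole ∕ bubble in the vertex slots — `Literature…Beta.KernelWard` §4–§5 re-instanced
# with `Decays A C δ ↦ KernelWard.Bdd A C` ([folklore]; nothing of the manuscripts)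

HONEST DEPENDENCY (page 1, mandatory): continuum YM on T⁴ ⇐ BetaPertH ∧ nine spine estimates (0/9 proved); BetaPertH ⇐ (D1) ∧ (D4) ∧ CAP+tail;
G-an2-4 gates asym, D1 and NE2/3/4.  HONEST FRAMING (cell contract, verbatim): «discharging `BetaPertH` makes Bałaban's UV stability UNCONDITIONAL —
a real constructive-QFT result; it is NOT the continuum limit and NOT the Clay problem.»  THIS MODULE DISCHARGES NOTHING of the wall: [folklore] absolutely
convergent rearrangements over an2's ABSTRACT bricks (`KernelWard.comp_assoc_of_bound`, `tr_comp_comm_of_bound`, `comp_sub_left∕right`, `tr_sub`, `comp_finset_sum_*`,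
`tr_finset_sum`, `slices_bdd_biLoc` — leg-agnostic) and the BF-x road's right-localised bounds (`D1BFx.ContactCount.abs_comp_le_of_entryBound`, `abs_comp_le_of_rightLoc`,
`abs_trTerm_le_of_rightLoc`); 0 def, 0 `def … : Prop`, nothing cited, 0 sorry; NOT hgerm, NOT D1, NOT BetaPertH, NOT continuum, NOT Clay.

ABSOLUTE RULE (cell charter, verbatim): «No internally-minted statement may enter as a cited fact. Every hypothesis is either kernel-proved in this package or a
verbatim quotation of a PUBLISHED theorem with page reference. The manuscript(s) under audit are NOT citable for their own disputed steps — they are the thing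
under adjudication; programme-internal (2001/route/tribunal) claims are never citable.»

WHY (LOCATED READING L-gan24leaf02-g39-2, owner AGREED journal l.26457): the tree's Ward ∕ reflection producers for `hessKer` take `Decays A C δ`; `PiBF`'s legs are power-law.
A bounded leg composed with a bi-localised kernel is localised in its SECOND variable («rl at `q`»: `∀ x y a b, |P x y a b| ≤ K·e^{−δ|y−q|₁}`), and traces of such
compositions against bi-localised kernels converge absolutely — enough for every step of the Ward computation (part 2 `FP/KernelWardBounded`).
CONTENT: §1 `rl_of_biLoc`, `bdd_of_rl`, `rl_sub`, `rl_finset_sum`, `summable_trTerm_rl`, `summable_slice_rl_bdd`, `slices_rl_bdd`; §2 `comp_assoc_bdd_biLoc_biLoc`,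
`comp_assoc_rl_bdd_biLoc`, `comp_assoc_biLoc_bdd_biLoc`, `tr_comp_comm_rl_biLoc`; §3 **`tadpole_sum_sub_bdd`**, **`bubble_sum_sub_left_bdd`** (`KernelWard` §5 with `Decays ↦ Bdd`).
Provenance: G-an2-4 formalisation swarm seat b2b-balaban-gan24-formalise-leaf-02 gen 39 (cross-lane on road FP; sub-row H2-ASM-5a WARD HALF, owner GO l.26457), 2026-08-21.
-/

noncomputable section

namespace Summit.QuantumFields.BalabanUV.Beta.FP.KernelWardBoundedBricks

open Finset
open scoped BigOperators
open Literature.MathematicalPhysics.QuantumFieldTheory.Balaban1983to89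
open Literature.MathematicalPhysics.QuantumFieldTheory.Balaban1983to89.Beta
open B12Sec2to5 (l1 l1_nonneg)
open B6BondElimination (unitVec unitVec_apply)
open PolarizationSign (WardTransversal)
open ExpKernelCalculus (MKer Decays BiLoc comp tr bubble tadpole VertexFamily VertexFamily₂ hess hessKer BlockCovariant Zl Zl_pos hess_eq_hessKer
  summable_exp_shift' tsum_exp_shift' biLoc_comp_biLoc l1_sub_triangle)
open KernelWard (Bdd bdd_of_biLoc biLoc_recentre biLoc_sub biLoc_finset_sum slices_bdd_biLoc comp_sub_right comp_sub_left tr_sub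
  comp_finset_sum_right comp_finset_sum_left tr_finset_sum comp_assoc_of_bound tr_comp_comm_of_bound divV divW)
open Summit.QuantumFields.BalabanUV.Beta.D1BFx.ContactCount (abs_comp_le_of_entryBound abs_comp_le_of_rightLoc abs_trTerm_le_of_rightLoc)

variable {D : ℕ} {F : Type*} [Fintype F]

/-! ## §1 Right-localised kernels (localised in the second variable): bookkeeping -/

section RightLoc

variable {P Q K L : MKer D F} {B C Kp Kq δ : ℝ} {p q : Fin D → ℤ}

omit [Fintype F] in
/-- [folklore] a bi-localised kernel is right-localised (drop the first-variable decay). -/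
theorem rl_of_biLoc (h : BiLoc K p q C δ) (hδ : 0 ≤ δ) : ∀ x y a b, |K x y a b| ≤ C * Real.exp (-δ * l1 (y - q)) := by
  intro x y a b
  have h1 := h x y a b
  have hC : 0 ≤ C := nonneg_of_mul_nonneg_left ((abs_nonneg _).trans h1) (Real.exp_pos _)
  refine h1.trans (mul_le_mul_of_nonneg_left (Real.exp_le_exp.mpr ?_) hC)
  nlinarith [l1_nonneg (x - p), l1_nonneg (y - q)]

omit [Fintype F] in
/-- [folklore] a right-localised kernel (rate `δ ≥ 0`) is bounded by its constant. -/
theorem bdd_of_rl (h : ∀ x y a b, |P x y a b| ≤ Kp * Real.exp (-δ * l1 (y - q))) (hδ : 0 ≤ δ) : Bdd P Kp := by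
  intro x y a b
  have h1 := h x y a b
  have hK : 0 ≤ Kp := nonneg_of_mul_nonneg_left ((abs_nonneg _).trans h1) (Real.exp_pos _)
  refine h1.trans ?_
  have : Real.exp (-δ * l1 (y - q)) ≤ 1 := Real.exp_le_one_iff.mpr (by nlinarith [l1_nonneg (y - q)])
  calc Kp * Real.exp (-δ * l1 (y - q)) ≤ Kp * 1 := mul_le_mul_of_nonneg_left this hK
    _ = Kp := mul_one _

omit [Fintype F] in
/-- [folklore] difference of two kernels right-localised at the same point. -/
theorem rl_sub (hP : ∀ x y a b, |P x y a b| ≤ Kp * Real.exp (-δ * l1 (y - q))) (hQ : ∀ x y a b, |Q x y a b| ≤ Kq * Real.exp (-δ * l1 (y - q))) :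
    ∀ x y a b, |(P - Q) x y a b| ≤ (Kp + Kq) * Real.exp (-δ * l1 (y - q)) := by
  intro x y a b
  show |P x y a b - Q x y a b| ≤ _
  calc |P x y a b - Q x y a b| ≤ |P x y a b| + |Q x y a b| := abs_sub _ _
    _ ≤ Kp * Real.exp (-δ * l1 (y - q)) + Kq * Real.exp (-δ * l1 (y - q)) := add_le_add (hP x y a b) (hQ x y a b)
    _ = (Kp + Kq) * Real.exp (-δ * l1 (y - q)) := by ring

omit [Fintype F] in
/-- [folklore] finite sum of kernels right-localised at the same point. -/
theorem rl_finset_sum {ι : Type*} (s : Finset ι) {M : ι → MKer D F} {Km : ι → ℝ}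
    (h : ∀ i ∈ s, ∀ x y a b, |M i x y a b| ≤ Km i * Real.exp (-δ * l1 (y - q))) :
    ∀ x y a b, |(∑ i ∈ s, M i) x y a b| ≤ (∑ i ∈ s, Km i) * Real.exp (-δ * l1 (y - q)) := by
  classical
  intro x y a b
  simp only [Finset.sum_apply]
  calc |∑ i ∈ s, M i x y a b| ≤ ∑ i ∈ s, |M i x y a b| := Finset.abs_sum_le_sum_abs _ _
    _ ≤ ∑ i ∈ s, Km i * Real.exp (-δ * l1 (y - q)) := Finset.sum_le_sum fun i hi => h i hi x y a b
    _ = (∑ i ∈ s, Km i) * Real.exp (-δ * l1 (y - q)) := by rw [Finset.sum_mul]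

/-- [folklore] the trace series of a right-localised kernel converges absolutely. -/
theorem summable_trTerm_rl (hP : ∀ x y a b, |P x y a b| ≤ Kp * Real.exp (-δ * l1 (y - q))) (hδ : 0 < δ) :
    Summable fun x : Fin D → ℤ => ∑ a, P x x a a :=
  Summable.of_norm_bounded ((summable_exp_shift' hδ q).mul_left ((Fintype.card F : ℝ) * Kp)) fun x => by
    rw [Real.norm_eq_abs]; exact abs_trTerm_le_of_rightLoc hP x

omit [Fintype F] in
/-- [folklore] one middle-leg slice, right-localised ∘ bounded. -/
theorem summable_slice_rl_bdd (hP : ∀ x y a b, |P x y a b| ≤ Kp * Real.exp (-δ * l1 (y - q))) (hL : Bdd L B) (hδ : 0 < δ)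
    (x z : Fin D → ℤ) (a f b : F) : Summable fun y : Fin D → ℤ => P x y a f * L y z f b := by
  refine Summable.of_norm_bounded ((summable_exp_shift' hδ q).mul_left (Kp * B)) (fun y => ?_)
  rw [Real.norm_eq_abs, abs_mul]
  have h1 := hP x y a f
  have h2 := hL y z f b
  calc |P x y a f| * |L y z f b| ≤ (Kp * Real.exp (-δ * l1 (y - q))) * B := mul_le_mul h1 h2 (abs_nonneg _) ((abs_nonneg _).trans h1)
    _ = Kp * B * Real.exp (-δ * l1 (y - q)) := by ring

/-- [folklore] fibre-summed slices, right-localised ∘ bounded. -/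
theorem slices_rl_bdd (hP : ∀ x y a b, |P x y a b| ≤ Kp * Real.exp (-δ * l1 (y - q))) (hL : Bdd L B) (hδ : 0 < δ)
    (x z : Fin D → ℤ) (a b : F) : Summable fun y : Fin D → ℤ => ∑ f, P x y a f * L y z f b :=
  summable_sum fun f _ => summable_slice_rl_bdd hP hL hδ x z a f b

end RightLoc

/-! ## §2 The three Fubini instances with `Bdd × BiLoc` majorants -/

section Fubini

variable {A P K L : MKer D F} {C Ck Cl Kp δ : ℝ} {p q p' q' : Fin D → ℤ}

/-- [folklore] associativity, bounded ∘ bi-localised ∘ bi-localised (the majorant of `KernelWard.comp_assoc_dbb` uses only the bound on `A`). -/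
theorem comp_assoc_bdd_biLoc_biLoc (hA : Bdd A C) (hK : BiLoc K p q Ck δ) (hL : BiLoc L p' q' Cl δ) (hδ : 0 < δ) :
    comp A (comp K L) = comp (comp A K) L := by
  refine comp_assoc_of_bound fun x w a b => ?_
  have hC : 0 ≤ C := (abs_nonneg _).trans (hA x w a b)
  have hCk : 0 ≤ Ck := hK.nonneg a
  have hCl : 0 ≤ Cl := hL.nonneg a
  refine ⟨fun y => C * Ck * Cl * Real.exp (-δ * l1 (y - p)), fun z => Real.exp (-δ * l1 (z - q)),
    (summable_exp_shift' hδ p).mul_left _, summable_exp_shift' hδ q, fun y => by positivity, fun z => by positivity,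
    fun y z f g => ?_⟩
  have h1 : |A x y a f| ≤ C := hA x y a f
  have h2 : |K y z f g| ≤ Ck * Real.exp (-δ * l1 (y - p)) * Real.exp (-δ * l1 (z - q)) := by
    have := hK y z f g
    rwa [show -δ * (l1 (y - p) + l1 (z - q)) = -δ * l1 (y - p) + -δ * l1 (z - q) by ring, Real.exp_add, ← mul_assoc] at this
  have h3 : |L z w g b| ≤ Cl := bdd_of_biLoc hL hδ.le z w g b
  rw [abs_mul, abs_mul]
  calc |A x y a f| * |K y z f g| * |L z w g b| ≤ C * (Ck * Real.exp (-δ * l1 (y - p)) * Real.exp (-δ * l1 (z - q))) * Cl :=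
        mul_le_mul (mul_le_mul h1 h2 (abs_nonneg _) hC) h3 (abs_nonneg _) (mul_nonneg hC (by positivity))
    _ = C * Ck * Cl * Real.exp (-δ * l1 (y - p)) * Real.exp (-δ * l1 (z - q)) := by ring

/-- [folklore] associativity, right-localised ∘ bounded ∘ bi-localised. -/
theorem comp_assoc_rl_bdd_biLoc (hP : ∀ x y a b, |P x y a b| ≤ Kp * Real.exp (-δ * l1 (y - q))) (hA : Bdd A C) (hL : BiLoc L p' q' Cl δ)
    (hδ : 0 < δ) : comp P (comp A L) = comp (comp P A) L := by
  refine comp_assoc_of_bound fun x w a b => ?_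
  have hKp : 0 ≤ Kp := nonneg_of_mul_nonneg_left ((abs_nonneg _).trans (hP x x a a)) (Real.exp_pos _)
  have hC : 0 ≤ C := (abs_nonneg _).trans (hA x w a b)
  have hCl : 0 ≤ Cl := hL.nonneg a
  refine ⟨fun y => Kp * C * Cl * Real.exp (-δ * l1 (y - q)), fun z => Real.exp (-δ * l1 (z - p')),
    (summable_exp_shift' hδ q).mul_left _, summable_exp_shift' hδ p', fun y => by positivity, fun z => by positivity,
    fun y z f g => ?_⟩
  have h1 : |P x y a f| ≤ Kp * Real.exp (-δ * l1 (y - q)) := hP x y a f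
  have h2 : |A y z f g| ≤ C := hA y z f g
  have h3 : |L z w g b| ≤ Cl * Real.exp (-δ * l1 (z - p')) := by
    refine (hL z w g b).trans (mul_le_mul_of_nonneg_left (Real.exp_le_exp.mpr ?_) hCl)
    nlinarith [l1_nonneg (w - q'), hδ.le]
  rw [abs_mul, abs_mul]
  calc |P x y a f| * |A y z f g| * |L z w g b| ≤ (Kp * Real.exp (-δ * l1 (y - q))) * C * (Cl * Real.exp (-δ * l1 (z - p'))) :=
        mul_le_mul (mul_le_mul h1 h2 (abs_nonneg _) (by positivity)) h3 (abs_nonneg _) (by positivity)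
    _ = Kp * C * Cl * Real.exp (-δ * l1 (y - q)) * Real.exp (-δ * l1 (z - p')) := by ring

/-- [folklore] associativity, bi-localised ∘ bounded ∘ bi-localised. -/
theorem comp_assoc_biLoc_bdd_biLoc {Cp : ℝ} (hP : BiLoc P p q Cp δ) (hA : Bdd A C) (hL : BiLoc L p' q' Cl δ) (hδ : 0 < δ) :
    comp P (comp A L) = comp (comp P A) L :=
  comp_assoc_rl_bdd_biLoc (rl_of_biLoc hP hδ.le) hA hL hδ

/-- [folklore] cyclicity of the trace, right-localised ∘ bi-localised. -/
theorem tr_comp_comm_rl_biLoc (hK : ∀ x y a b, |K x y a b| ≤ Kp * Real.exp (-δ * l1 (y - q))) (hL : BiLoc L p' q' Cl δ) (hδ : 0 < δ) :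
    tr (comp K L) = tr (comp L K) := by
  classical
  by_cases hF : Nonempty F
  · obtain ⟨a₀⟩ := hF
    have hKp : 0 ≤ Kp := nonneg_of_mul_nonneg_left ((abs_nonneg _).trans (hK q q a₀ a₀)) (Real.exp_pos _)
    have hCl : 0 ≤ Cl := hL.nonneg a₀
    refine tr_comp_comm_of_bound ⟨fun x => Kp * Cl * Real.exp (-δ * l1 (x - q')), fun y => Real.exp (-δ * l1 (y - q)),
      (summable_exp_shift' hδ q').mul_left _, summable_exp_shift' hδ q, fun x => by positivity, fun y => by positivity,
      fun x y a f => ?_⟩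
    have h1 : |K x y a f| ≤ Kp * Real.exp (-δ * l1 (y - q)) := hK x y a f
    have h2 : |L y x f a| ≤ Cl * Real.exp (-δ * l1 (x - q')) := by
      refine (hL y x f a).trans (mul_le_mul_of_nonneg_left (Real.exp_le_exp.mpr ?_) hCl)
      nlinarith [l1_nonneg (y - p'), hδ.le]
    rw [abs_mul]
    calc |K x y a f| * |L y x f a| ≤ (Kp * Real.exp (-δ * l1 (y - q))) * (Cl * Real.exp (-δ * l1 (x - q'))) :=
          mul_le_mul h1 h2 (abs_nonneg _) (by positivity)
      _ = Kp * Cl * Real.exp (-δ * l1 (x - q')) * Real.exp (-δ * l1 (y - q)) := by ring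
  · have hE : IsEmpty F := not_nonempty_iff.mp hF
    simp [ExpKernelCalculus.tr]

end Fubini

/-! ## §3 Linearity of tadpole and bubble in the vertex slots, bounded leg -/

section Linear

variable {ι : Type*} {A W : MKer D F} {C Cw δ : ℝ} {p q : Fin D → ℤ}

/-- [folklore] `tadpole A (Σ_i (W₁ i − W₂ i)) = Σ_i (tadpole A (W₁ i) − tadpole A (W₂ i))` for a BOUNDED leg and second-order vertex kernels bi-localised at
common points (`KernelWard.tadpole_sum_sub` with `Decays ↦ Bdd`). -/
theorem tadpole_sum_sub_bdd (s : Finset ι) {W₁ W₂ : ι → MKer D F} {C₁ C₂ : ι → ℝ} (hA : Bdd A C)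
    (h₁ : ∀ i ∈ s, BiLoc (W₁ i) p q (C₁ i) δ) (h₂ : ∀ i ∈ s, BiLoc (W₂ i) p q (C₂ i) δ) (hδ : 0 < δ) :
    tadpole A (∑ i ∈ s, (W₁ i - W₂ i)) = ∑ i ∈ s, (tadpole A (W₁ i) - tadpole A (W₂ i)) := by
  classical
  by_cases hF : Nonempty F
  swap
  · have hE : IsEmpty F := not_nonempty_iff.mp hF
    simp [ExpKernelCalculus.tadpole, ExpKernelCalculus.tr]
  obtain ⟨a₀⟩ := hF
  have hC : 0 ≤ C := (abs_nonneg _).trans (hA p p a₀ a₀)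
  have hs₁ : ∀ i ∈ s, ∀ x z a b, Summable fun y : Fin D → ℤ => ∑ f, A x y a f * W₁ i y z f b :=
    fun i hi => slices_bdd_biLoc hA (h₁ i hi) hδ
  have hs₂ : ∀ i ∈ s, ∀ x z a b, Summable fun y : Fin D → ℤ => ∑ f, A x y a f * W₂ i y z f b :=
    fun i hi => slices_bdd_biLoc hA (h₂ i hi) hδ
  have hS₁ := biLoc_finset_sum s h₁
  have hS₂ := biLoc_finset_sum s h₂
  have e1 : comp A (∑ i ∈ s, (W₁ i - W₂ i)) = ∑ i ∈ s, comp A (W₁ i) - ∑ i ∈ s, comp A (W₂ i) := by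
    rw [Finset.sum_sub_distrib, comp_sub_right (slices_bdd_biLoc hA hS₁ hδ) (slices_bdd_biLoc hA hS₂ hδ),
      comp_finset_sum_right s hs₁, comp_finset_sum_right s hs₂]
  have hM₁ : ∀ i ∈ s, Summable fun x : Fin D → ℤ => ∑ a, comp A (W₁ i) x x a a :=
    fun i hi => summable_trTerm_rl (abs_comp_le_of_entryBound hC hA (h₁ i hi) hδ) hδ
  have hM₂ : ∀ i ∈ s, Summable fun x : Fin D → ℤ => ∑ a, comp A (W₂ i) x x a a :=
    fun i hi => summable_trTerm_rl (abs_comp_le_of_entryBound hC hA (h₂ i hi) hδ) hδ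
  have hN₁ : Summable fun x : Fin D → ℤ => ∑ a, (∑ i ∈ s, comp A (W₁ i)) x x a a := by
    have : (fun x : Fin D → ℤ => ∑ a, (∑ i ∈ s, comp A (W₁ i)) x x a a) = fun x => ∑ i ∈ s, ∑ a, comp A (W₁ i) x x a a := by
      funext x; simp only [Finset.sum_apply]; rw [Finset.sum_comm]
    rw [this]; exact summable_sum fun i hi => hM₁ i hi
  have hN₂ : Summable fun x : Fin D → ℤ => ∑ a, (∑ i ∈ s, comp A (W₂ i)) x x a a := by
    have : (fun x : Fin D → ℤ => ∑ a, (∑ i ∈ s, comp A (W₂ i)) x x a a) = fun x => ∑ i ∈ s, ∑ a, comp A (W₂ i) x x a a := by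
      funext x; simp only [Finset.sum_apply]; rw [Finset.sum_comm]
    rw [this]; exact summable_sum fun i hi => hM₂ i hi
  unfold ExpKernelCalculus.tadpole
  rw [e1, tr_sub hN₁ hN₂, tr_finset_sum s hM₁, tr_finset_sum s hM₂, ← Finset.sum_sub_distrib]

/-- [folklore] `bubble A (Σ_i (K₁ i − K₂ i)) W = Σ_i (bubble A (K₁ i) W − bubble A (K₂ i) W)` for a BOUNDED leg, first-slot vertex kernels bi-localised at a common
point and `W` bi-localised (`KernelWard.bubble_sum_sub_left` with `Decays ↦ Bdd`; the composed kernels `A∘K` are RIGHT-localised). -/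
theorem bubble_sum_sub_left_bdd (s : Finset ι) {K₁ K₂ : ι → MKer D F} {C₁ C₂ : ι → ℝ} (hA : Bdd A C)
    (h₁ : ∀ i ∈ s, BiLoc (K₁ i) p p (C₁ i) δ) (h₂ : ∀ i ∈ s, BiLoc (K₂ i) p p (C₂ i) δ) (hW : BiLoc W q q Cw δ) (hδ : 0 < δ) :
    bubble A (∑ i ∈ s, (K₁ i - K₂ i)) W = ∑ i ∈ s, (bubble A (K₁ i) W - bubble A (K₂ i) W) := by
  classical
  by_cases hF : Nonempty F
  swap
  · have hE : IsEmpty F := not_nonempty_iff.mp hF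
    simp [ExpKernelCalculus.bubble, ExpKernelCalculus.tr]
  obtain ⟨a₀⟩ := hF
  have hC : 0 ≤ C := (abs_nonneg _).trans (hA p p a₀ a₀)
  -- the composed kernels: right-localised
  have hY := abs_comp_le_of_entryBound hC hA hW hδ
  have hYb := bdd_of_rl hY hδ.le
  have hX₁ : ∀ i ∈ s, ∀ x z a b, |comp A (K₁ i) x z a b| ≤ (Fintype.card F : ℝ) * (C * C₁ i) * Zl D δ * Real.exp (-δ * l1 (z - p)) :=
    fun i hi => abs_comp_le_of_entryBound hC hA (h₁ i hi) hδ
  have hX₂ : ∀ i ∈ s, ∀ x z a b, |comp A (K₂ i) x z a b| ≤ (Fintype.card F : ℝ) * (C * C₂ i) * Zl D δ * Real.exp (-δ * l1 (z - p)) :=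
    fun i hi => abs_comp_le_of_entryBound hC hA (h₂ i hi) hδ
  -- step 1: distribute `comp A`
  have hs₁ : ∀ i ∈ s, ∀ x z a b, Summable fun y : Fin D → ℤ => ∑ f, A x y a f * K₁ i y z f b :=
    fun i hi => slices_bdd_biLoc hA (h₁ i hi) hδ
  have hs₂ : ∀ i ∈ s, ∀ x z a b, Summable fun y : Fin D → ℤ => ∑ f, A x y a f * K₂ i y z f b :=
    fun i hi => slices_bdd_biLoc hA (h₂ i hi) hδ
  have hS₁ := biLoc_finset_sum s h₁
  have hS₂ := biLoc_finset_sum s h₂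
  have e1 : comp A (∑ i ∈ s, (K₁ i - K₂ i)) = ∑ i ∈ s, comp A (K₁ i) - ∑ i ∈ s, comp A (K₂ i) := by
    rw [Finset.sum_sub_distrib, comp_sub_right (slices_bdd_biLoc hA hS₁ hδ) (slices_bdd_biLoc hA hS₂ hδ),
      comp_finset_sum_right s hs₁, comp_finset_sum_right s hs₂]
  -- step 2: distribute the right composition with `Y := comp A W`
  have hT₁ := rl_finset_sum s hX₁
  have hT₂ := rl_finset_sum s hX₂
  have e2 : comp (∑ i ∈ s, comp A (K₁ i) - ∑ i ∈ s, comp A (K₂ i)) (comp A W)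
      = ∑ i ∈ s, comp (comp A (K₁ i)) (comp A W) - ∑ i ∈ s, comp (comp A (K₂ i)) (comp A W) := by
    rw [comp_sub_left (slices_rl_bdd hT₁ hYb hδ) (slices_rl_bdd hT₂ hYb hδ),
      comp_finset_sum_left s (fun i hi => slices_rl_bdd (hX₁ i hi) hYb hδ),
      comp_finset_sum_left s (fun i hi => slices_rl_bdd (hX₂ i hi) hYb hδ)]
  -- step 3: distribute the trace
  have hM₁ : ∀ i ∈ s, Summable fun x : Fin D → ℤ => ∑ a, comp (comp A (K₁ i)) (comp A W) x x a a :=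
    fun i hi => summable_trTerm_rl (abs_comp_le_of_rightLoc (hX₁ i hi) hY hδ) hδ
  have hM₂ : ∀ i ∈ s, Summable fun x : Fin D → ℤ => ∑ a, comp (comp A (K₂ i)) (comp A W) x x a a :=
    fun i hi => summable_trTerm_rl (abs_comp_le_of_rightLoc (hX₂ i hi) hY hδ) hδ
  have hN₁ : Summable fun x : Fin D → ℤ => ∑ a, (∑ i ∈ s, comp (comp A (K₁ i)) (comp A W)) x x a a := by
    have : (fun x : Fin D → ℤ => ∑ a, (∑ i ∈ s, comp (comp A (K₁ i)) (comp A W)) x x a a)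
        = fun x => ∑ i ∈ s, ∑ a, comp (comp A (K₁ i)) (comp A W) x x a a := by
      funext x; simp only [Finset.sum_apply]; rw [Finset.sum_comm]
    rw [this]; exact summable_sum fun i hi => hM₁ i hi
  have hN₂ : Summable fun x : Fin D → ℤ => ∑ a, (∑ i ∈ s, comp (comp A (K₂ i)) (comp A W)) x x a a := by
    have : (fun x : Fin D → ℤ => ∑ a, (∑ i ∈ s, comp (comp A (K₂ i)) (comp A W)) x x a a)
        = fun x => ∑ i ∈ s, ∑ a, comp (comp A (K₂ i)) (comp A W) x x a a := by
      funext x; simp only [Finset.sum_apply]; rw [Finset.sum_comm]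
    rw [this]; exact summable_sum fun i hi => hM₂ i hi
  unfold ExpKernelCalculus.bubble
  rw [e1, e2, tr_sub hN₁ hN₂, tr_finset_sum s hM₁, tr_finset_sum s hM₂, ← Finset.sum_sub_distrib]

end Linear

end Summit.QuantumFields.BalabanUV.Beta.FP.KernelWardBoundedBricks

end
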